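import Literature.MathematicalPhysics.QuantumLattice.GrassmannKernelsGenProd
import Literature.MathematicalPhysics.QuantumLattice.GrassmannPairLaplacians
import Mathlib.Data.Finset.Sort
import Mathlib.Order.Interval.Finset.Fin
import HarnessLib

/-!
# Sub-monomials of a label string and the deletion formulas for `∂_X` and `Δ_C`

Topic `Literature/MathematicalPhysics/QuantumLattice`; bookkeeping for the single-scale tree estimate in
the Laplacian host (`GrassmannLaplacianTreeExpansion.lean`).  The tree-factor operators
`∏_ℓ Δ_{C|ℓ} e^{Δ_{σ∘C}}` and the kernel extraction `∂_{W_{r-1}} ⋯ ∂_{W_0}` act on a monomial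
`ψ(Z₀)⋯ψ(Z_{N-1})` by DELETING fields; to keep all the resulting monomials indexed by one type we work
with the **sub-monomials** `genProdOn Z S = ∏_{i ∈ S, increasing} ψ(Z_i)` of a fixed label string
`Z : Fin N → Γ`, `S ⊆ Fin N` (`genProdOn_eq`, `genProdOn_univ`, `genProdOn_empty`; support and parity:
`genProdOn_mem_fieldSubalgebra`, `genProd_mem_evenOdd`, `genProdOn_mem_evenOdd`).  PROVED:

* (private) `card_filter_lt_subsetEnum`, `subsetEnum_comp_succAbove` — the increasing enumeration of
  `S` with its `k`-th element removed is the enumeration of `S ∖ {k-th element}` (as in `FermionGammaFunctor.lean`);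
* **`grassmannDeriv_genProdOn`** — `∂_X ∏_{i∈S} ψ(Z_i) = Σ_{i ∈ S, Z_i = X} (-1)^{#{j ∈ S : j < i}} ∏_{S ∖ i} ψ`
  (the graded Leibniz rule `grassmannDeriv_genProd` transported to subsets);
* **`grassmannLaplacian_genProdOn`** — `Δ_{C'} ∏_{S} ψ = ½ Σ_{j ∈ S} Σ_{i ∈ S∖j} ± C'(Z_i, Z_j) ∏_{S∖{i,j}} ψ`:
  a Laplacian deletes an ordered pair of fields with the propagator as coefficient (Salmhofer 1999,
  (4.86); the tree and loop lines of Benfatto–Giuliani–Mastropietro 2006, (2.66)).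

Everything is proved; no named fact.

## Sources

M. Salmhofer, *Renormalization* (1999), §4.3.1 (4.86) (`Salmhofer1999`); F. A. Berezin, *The Method of
Second Quantization* (1966), Ch. I §3 (`Berezin1966`); G. Benfatto, A. Giuliani, V. Mastropietro, Ann.
Henri Poincaré 7 (2006), (2.66) (`BenfattoGiulianiMastropietro2006`).
-/

noncomputable section

namespace Literature.MathematicalPhysics.QuantumLattice

open GrassmannAlgebra Finset

/-! ### Enumerations of a subset with one element removed -/

section Enumeration

variable {N : ℕ}

/-- The `k`-th element of `S` in increasing order has exactly `k` elements of `S` below it (a private copy of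
the lemma of `FermionGammaFunctor.lean`, to keep the imports light). [folklore] -/
private theorem card_filter_lt_subsetEnum (S : Finset (Fin N)) {m : ℕ} (h : S.card = m) (k : Fin m) :
    (S.filter fun x => x < S.orderEmbOfFin h k).card = k := by
  have hS : S.filter (fun x => x < S.orderEmbOfFin h k) = (Finset.Iio k).map (S.orderEmbOfFin h).toEmbedding := by
    ext x
    simp only [mem_filter, mem_map, mem_Iio, RelEmbedding.coe_toEmbedding]
    constructor
    · rintro ⟨hx, hlt⟩
      have hx' : x ∈ Set.range (S.orderEmbOfFin h) := by rw [range_orderEmbOfFin]; exact hx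
      obtain ⟨j, rfl⟩ := hx'
      exact ⟨j, (S.orderEmbOfFin h).lt_iff_lt.1 hlt, rfl⟩
    · rintro ⟨j, hj, rfl⟩
      exact ⟨orderEmbOfFin_mem _ _ _, (S.orderEmbOfFin h).lt_iff_lt.2 hj⟩
  rw [hS, card_map, Fin.card_Iio]

/-- Removing the `k`-th element: the enumeration of `S` composed with `k.succAbove` is the enumeration of
`S ∖ {k-th element}` (private copy, cf. `FermionGammaFunctor.lean`). [folklore] -/
private theorem subsetEnum_comp_succAbove (S : Finset (Fin N)) {m : ℕ} (h : S.card = m + 1) (k : Fin (m + 1))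
    (h' : (S.erase (S.orderEmbOfFin h k)).card = m) :
    (S.orderEmbOfFin h) ∘ k.succAbove = (S.erase (S.orderEmbOfFin h k)).orderEmbOfFin h' :=
  orderEmbOfFin_unique h'
    (fun x => mem_erase.2 ⟨fun he => Fin.succAbove_ne k x ((S.orderEmbOfFin h).injective he), orderEmbOfFin_mem _ _ _⟩)
    ((S.orderEmbOfFin h).strictMono.comp (Fin.strictMono_succAbove k))

/-- The cardinality of `S` with its `k`-th element removed. [folklore] -/
theorem card_erase_orderEmbOfFin (S : Finset (Fin N)) {m : ℕ} (h : S.card = m + 1) (k : Fin (m + 1)) :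
    (S.erase (S.orderEmbOfFin h k)).card = m := by
  rw [card_erase_of_mem (orderEmbOfFin_mem _ _ _), h, Nat.add_sub_cancel]

end Enumeration

/-! ### Sub-monomials -/

section SubMonomial

variable (R : Type*) [CommRing R] {Γ : Type*} [DecidableEq Γ] {N : ℕ}

/-- The **sub-monomial** of the label string `Z` on the positions `S`: `∏_{i ∈ S, increasing} ψ(Z_i)`.
[folklore] -/
def genProdOn (Z : Fin N → Γ) (S : Finset (Fin N)) : GrassmannAlgebra R Γ :=
  genProd R (Z ∘ S.orderEmbOfFin rfl)

/-- The sub-monomial through any enumeration proof. [folklore] -/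
theorem genProdOn_eq (Z : Fin N → Γ) (S : Finset (Fin N)) {m : ℕ} (h : S.card = m) :
    genProdOn R Z S = genProd R (Z ∘ S.orderEmbOfFin h) := by
  subst h
  rfl

/-- All positions: the full monomial. [folklore] -/
theorem genProdOn_univ (Z : Fin N → Γ) : genProdOn R Z univ = genProd R Z := by
  rw [genProdOn_eq R Z univ (Finset.card_fin N)]
  have h := orderEmbOfFin_unique (Finset.card_fin N) (f := id) (fun _ => mem_univ _) strictMono_id
  congr 1
  funext i
  exact congrArg Z (congr_fun h i).symm

/-- No position: `1`. [folklore] -/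
theorem genProdOn_empty (Z : Fin N → Γ) : genProdOn R Z ∅ = 1 := by
  rw [genProdOn_eq R Z ∅ (card_empty)]
  exact genProd_zero R _

/-- A sub-monomial lies in the subalgebra of the fields at its positions. [folklore] -/
theorem genProdOn_mem_fieldSubalgebra (Z : Fin N → Γ) (S : Finset (Fin N)) :
    genProdOn R Z S ∈ fieldSubalgebra R (Z '' (S : Set (Fin N))) := by
  unfold genProdOn genProd
  refine Subalgebra.list_prod_mem _ fun a ha => ?_
  rw [List.mem_ofFn] at ha
  obtain ⟨i, rfl⟩ := ha
  exact gen_mem_fieldSubalgebra R ⟨_, mem_coe.2 (orderEmbOfFin_mem _ _ _), rfl⟩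

/-- A monomial of degree `m` has parity `m`. [folklore] -/
theorem genProd_mem_evenOdd : ∀ {m : ℕ} (Y : Fin m → Γ), genProd R Y ∈ evenOdd R (m : ZMod 2)
  | 0, Y => by rw [genProd_zero, Nat.cast_zero]; exact one_mem_evenOdd_zero R
  | m + 1, Y => by
    rw [genProd_succ, Nat.cast_succ, add_comm]
    exact SetLike.mul_mem_graded (gen_mem_evenOdd_one R _) (genProd_mem_evenOdd (Fin.tail Y))

/-- A sub-monomial on `S` has parity `|S|`. [folklore] -/
theorem genProdOn_mem_evenOdd (Z : Fin N → Γ) (S : Finset (Fin N)) :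
    genProdOn R Z S ∈ evenOdd R (S.card : ZMod 2) :=
  genProd_mem_evenOdd R _

/-! ### One derivative deletes one field -/

/-- **A derivative deletes one field of a sub-monomial**:
`∂_X ∏_{i ∈ S} ψ(Z_i) = Σ_{i ∈ S, Z_i = X} (-1)^{#{j ∈ S : j < i}} ∏_{i' ∈ S ∖ i} ψ(Z_{i'})` (the graded Leibniz rule).
[cite: Berezin1966, Ch. I §3] -/
theorem grassmannDeriv_genProdOn (Z : Fin N → Γ) (S : Finset (Fin N)) (X : Γ) :
    grassmannDeriv R X (genProdOn R Z S) =
      ∑ i ∈ S, if Z i = X then ((-1 : R) ^ (S.filter (· < i)).card) • genProdOn R Z (S.erase i) else 0 := by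
  cases hc : S.card with
  | zero =>
    rw [Finset.card_eq_zero.1 hc, genProdOn_empty, grassmannDeriv_one, sum_empty]
  | succ m =>
    have hsum : (∑ i ∈ S, if Z i = X then ((-1 : R) ^ (S.filter (· < i)).card) • genProdOn R Z (S.erase i) else 0) =
        ∑ k : Fin (m + 1), if Z (S.orderEmbOfFin hc k) = X then
          ((-1 : R) ^ (S.filter (· < S.orderEmbOfFin hc k)).card) • genProdOn R Z (S.erase (S.orderEmbOfFin hc k)) else 0 := by
      rw [← sum_coe_sort]
      refine Fintype.sum_equiv (S.orderIsoOfFin hc).symm.toEquiv _ _ fun x => ?_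
      have hx : S.orderEmbOfFin hc ((S.orderIsoOfFin hc).symm x) = (x : Fin N) := by
        rw [← Finset.coe_orderIsoOfFin_apply, OrderIso.apply_symm_apply]
      simp only [OrderIso.coe_toEquiv, hx]
    rw [genProdOn_eq R Z S hc, grassmannDeriv_genProd, hsum]
    refine sum_congr rfl fun k _ => ?_
    rw [Function.comp_apply]
    by_cases h : Z (S.orderEmbOfFin hc k) = X
    · rw [if_pos h.symm, if_pos h, card_filter_lt_subsetEnum, genProdOn_eq R Z _ (card_erase_orderEmbOfFin S hc k),
        ← subsetEnum_comp_succAbove S hc k]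
      rfl
    · rw [if_neg (fun h' => h h'.symm), if_neg h]

/-! ### A Laplacian deletes an ordered pair of fields -/

variable [Fintype Γ] [Algebra ℚ R]

/-- **A Laplacian deletes an ordered pair of fields of a sub-monomial**, the propagator between the two
deleted fields as coefficient:
`Δ_{C'} ∏_{S} ψ(Z) = ½ Σ_{j ∈ S} Σ_{i ∈ S ∖ j} (-1)^{#{<j in S} + #{<i in S∖j}} C'(Z_i, Z_j) ∏_{S ∖ {j, i}} ψ(Z)`
(Salmhofer 1999, (4.86): `Δ_C = ½ Σ C(X,Y) ∂_X ∂_Y`). [cite: Salmhofer1999, §4.3.1 (4.86)] -/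
theorem grassmannLaplacian_genProdOn (C' : Matrix Γ Γ R) (Z : Fin N → Γ) (S : Finset (Fin N)) :
    grassmannLaplacian R C' (genProdOn R Z S) =
      ((1 / 2 : ℚ) • (1 : R)) • ∑ j ∈ S, ∑ i ∈ S.erase j,
        (C' (Z i) (Z j) * ((-1 : R) ^ ((S.filter (· < j)).card + ((S.erase j).filter (· < i)).card))) •
          genProdOn R Z ((S.erase j).erase i) := by
  -- `∂_Y` deletes `j` (the label sum collapses on `Y = Z j`) …
  have h1 : ∀ X, ∑ Y, C' X Y • grassmannDeriv R X (grassmannDeriv R Y (genProdOn R Z S)) =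
      ∑ j ∈ S, (C' X (Z j) * (-1 : R) ^ (S.filter (· < j)).card) • grassmannDeriv R X (genProdOn R Z (S.erase j)) := by
    intro X
    simp only [grassmannDeriv_genProdOn R Z S, map_sum, apply_ite (grassmannDeriv R X), map_zero, map_smul, smul_sum,
      smul_ite, smul_zero]
    rw [sum_comm]
    refine sum_congr rfl fun j _ => ?_
    rw [sum_ite_eq, if_pos (mem_univ _), smul_smul]
  -- … then `∂_X` deletes `i` (the label sum collapses on `X = Z i`)
  have h2 : ∑ X, ∑ j ∈ S, (C' X (Z j) * (-1 : R) ^ (S.filter (· < j)).card) • grassmannDeriv R X (genProdOn R Z (S.erase j)) =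
      ∑ j ∈ S, ∑ i ∈ S.erase j,
        (C' (Z i) (Z j) * ((-1 : R) ^ ((S.filter (· < j)).card + ((S.erase j).filter (· < i)).card))) •
          genProdOn R Z ((S.erase j).erase i) := by
    rw [sum_comm]
    refine sum_congr rfl fun j _ => ?_
    simp only [grassmannDeriv_genProdOn R Z (S.erase j), smul_sum, smul_ite, smul_zero]
    rw [sum_comm]
    refine sum_congr rfl fun i _ => ?_
    rw [sum_ite_eq, if_pos (mem_univ _), smul_smul, pow_add, mul_assoc]
  rw [grassmannLaplacian_apply]
  congr 1
  rw [← h2]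
  exact sum_congr rfl fun X _ => h1 X

end SubMonomial

end Literature.MathematicalPhysics.QuantumLattice
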